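import Summits.CriticalPhenomena.PercolationContinuityZ3.Theorems.FK.BoundaryConditionInfluenceZd
import Literature.Probability.LatticeModels.StochasticOrderCoupling
import Mathlib.Probability.ConditionalProbability
import HarnessLib

/-!
# FK-continuity cell, FO-10a: boundary-condition influence in TOTAL VARIATION — arbitrary local events, via
# Strassen's monotone coupling: `|P(E | H) − φ⁰_Λ(E)| ≤ Σ_{e ∈ F} φ¹_Λ(e ↔ ∂Λ)` for every FK-Gibbs measure `P`

Claimed R42 (8)(c) in the cell INBOX at 2026-08-28T10:00:12Z by fkp-10a gen 353 (NEW CLAIM #1 of the gen), under provision (ι) (no coordinator seated since gen 267's closing line l.8331: the lane lead absorbs the registry word, silence = consent; readers fk-ref / fkt-lead / fkp-18r / fkp-10b); lineage row FO-10a-g353 (self-suggested), package g353-weakmixing, label WM-C.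
Helper file of the `fk-continuity` build cell (bschramm lane; `--supports stmt-CriticalPhenomena-4575`); builds on
p205010 (kernel theorem, internal audit signed; external expert review pending). No definitions, no named facts, no
sorries; standard axioms.

The increasing-event bound of `BoundaryConditionInfluenceZd.lean` controls the ONE-EDGE marginals:
`φ¹_Λ(e open) − φ⁰_Λ(e open) ≤ φ¹_Λ(J(e, Λ))`, `J(e, Λ) = {∃ x ∈ e, ∃ y ∈ ∂Λ, x ↔ y in Λ}`; Strassen's theorem (the
tree's `exists_monotoneCoupling_of_isLocalEvent`) turns this into control in total variation on a window (Liggett's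
Cor. II.2.8): for `μ ≤_st ν` on `{0,1}^ι` and `E` determined by the finite set `F`,
`|ν(E) − μ(E)| ≤ Σ_{i ∈ F} (ν(i open) − μ(i open))` (`abs_measureReal_sub_le_sum_of_isLocalEvent_le`). Applied to
`μ = φ⁰_{Λ,p,q}` (read on `ℤ^d`) and any probability measure `ν` lying between `φ⁰_Λ` and `φ¹_Λ` on increasing
`E_Λ`-events — every FK-Gibbs measure `P`, its conditional laws `P(· | H)` given local information `H` off `E_Λ`,
and `φ¹_Λ` itself — this gives, for `E` ANY event determined by a set `F ⊆ E_Λ` of edges (`0 ≤ p ≤ 1`, `q ≥ 1`):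

* `abs_real_sub_regionFreeReal_le_sum_of_sandwich` (the core) and its instances `FKGibbs.abs_real_sub_regionFreeReal_le_sum`
  (**`|P(E) − φ⁰_Λ(E)| ≤ S_Λ(F)`**), `abs_regionWiredReal_sub_regionFreeReal_le_sum` (`|φ¹_Λ(E) − φ⁰_Λ(E)| ≤ S_Λ(F)`),
  `FKGibbs.abs_real_sub_regionWiredReal_le_two_mul_sum`, `FKGibbs.abs_condReal_sub_regionFreeReal_le_sum`
  (`|P(E | H) − φ⁰_Λ(E)| ≤ S_Λ(F)`), where `S_Λ(F) = Σ_{e ∈ F} φ¹_{Λ,p,q}(J(e, Λ))`;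
* `FKGibbs.abs_real_inter_sub_mul_le_two_mul_sum` — **WEAK MIXING FOR ARBITRARY LOCAL EVENTS:
  `|P(E ∩ H) − P(E)·P(H)| ≤ 2·P(H)·S_Λ(F)`** (Alexander 1998, (1.1) in the form `sup |P(A | B) − P(A)|`, p. 444);
* `FKGibbs.abs_real_sub_real_le_two_mul_sum` — two FK-Gibbs measures at `(p, q)` differ by at most `2·S_Λ(F)` on `E`;
On boxes `S_{Λ_n}(F) ≤ 2·|F|·thetaWiredBox d p q (n − k)` for `F ⊆ E_{Λ_k}` — a one-arm probability of the wired box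
measure, exponentially small below `p_c(q)` (`WeakMixingBelowCritical.lean`).

## References

* K. S. Alexander, *On weak mixing in lattice models*, PTRF 110 (1998) 441–471: (1.1), p. 444, §2 (2.7), Thm. 3.4. [Alexander1998]
* T. M. Liggett, *Interacting Particle Systems*, Springer 1985/2005, Ch. II Thm. 2.4 (Strassen) and Cor. 2.8. [Liggett2005]
* G. Grimmett, *The Random-Cluster Model*, Springer 2006: §2.1 (Strassen), Lemma (4.13), (4.14)(b), (4.21). [Grimmett2006]
* H. Duminil-Copin, *Lectures on the Ising and Potts models on the hypercubic lattice* (2019), §1.2 Exercise 10. [DuminilCopin2019]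
-/

noncomputable section

namespace Summit.CriticalPhenomena.PercolationContinuityZ3.Theorems.FK

namespace BoundaryInfluence

open MeasureTheory Finset
open Literature.Probability.Percolation Literature.Probability.LatticeModels Literature.Barriers.CriticalPhenomena
open Literature.Probability.Percolation.OneArmOSSS Literature.Probability.Percolation.DCT16 MonotonicOSSS

/-! ### Total variation on a window under a monotone coupling (Liggett's Cor. II.2.8 computation) -/

section Strassen

variable {ι : Type*}

/-- Under a coupling supported on `{ω₁ ⊆ ω₂}`, the two marginals differ on an event determined by the coordinates in
`F` by at most the sum over `i ∈ F` of the differences of the one-coordinate marginals (the disagreement set on `F`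
is covered by the events `{i ∈ ω₂ ∖ ω₁}`, `i ∈ F`, up to null sets). [cite: Liggett2005, Cor. II.2.8 (proof)] -/
theorem abs_measureReal_snd_sub_fst_le_sum (π : Measure (Set ι × Set ι)) [IsFiniteMeasure π]
    (hle : ∀ᵐ p ∂π, p.1 ⊆ p.2) (F : Finset ι) {E : Set (Set ι)} (hE : DeterminedBy E ↑F) :
    |π.real (Prod.snd ⁻¹' E) - π.real (Prod.fst ⁻¹' E)| ≤
      ∑ i ∈ F, (π.real {p | i ∈ p.2} - π.real {p | i ∈ p.1}) := by
  classical
  -- measurability of the coordinate events on the product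
  have hm1 : ∀ i : ι, Measurable fun p : Set ι × Set ι => i ∈ p.1 := fun i => (measurable_set_mem i).comp measurable_fst
  have hm2 : ∀ i : ι, Measurable fun p : Set ι × Set ι => i ∈ p.2 := fun i => (measurable_set_mem i).comp measurable_snd
  have hN0 : ∀ i : ι, π.real {p : Set ι × Set ι | i ∈ p.1 ∧ i ∉ p.2} = 0 := fun i => by
    rw [measureReal_def, measure_mem_fst_not_mem_snd_eq_zero hle i, ENNReal.toReal_zero]
  -- the disagreement set on `F`
  set U : Set (Set ι × Set ι) := ⋃ i ∈ F, ({p | i ∈ p.2 ∧ i ∉ p.1} ∪ {p | i ∈ p.1 ∧ i ∉ p.2}) with hU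
  have hdis : ∀ p : Set ι × Set ι, ¬ (p.1 ∈ E ↔ p.2 ∈ E) → p ∈ U := by
    intro p hp
    by_contra hpU
    apply hp
    refine (determinedBy_iff E ↑F).1 hE p.1 p.2 (Set.ext fun i => ?_)
    simp only [Set.mem_inter_iff, Finset.mem_coe]
    constructor
    · rintro ⟨hi1, hiF⟩
      refine ⟨by_contra fun hi2 => hpU ?_, hiF⟩
      rw [hU]; simp only [Set.mem_iUnion, Set.mem_union, Set.mem_setOf_eq, exists_prop]
      exact ⟨i, hiF, Or.inr ⟨hi1, hi2⟩⟩
    · rintro ⟨hi2, hiF⟩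
      refine ⟨by_contra fun hi1 => hpU ?_, hiF⟩
      rw [hU]; simp only [Set.mem_iUnion, Set.mem_union, Set.mem_setOf_eq, exists_prop]
      exact ⟨i, hiF, Or.inl ⟨hi2, hi1⟩⟩
  have hUle : π.real U ≤ ∑ i ∈ F, (π.real {p | i ∈ p.2} - π.real {p | i ∈ p.1}) := by
    refine (measureReal_biUnion_finset_le F _).trans (Finset.sum_le_sum fun i _ => (measureReal_union_le _ _).trans ?_)
    rw [hN0 i, add_zero]
    -- `π{i ∈ ω₂, i ∉ ω₁} = π{i ∈ ω₂} − π{i ∈ ω₁}`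
    have h1 : π.real {p : Set ι × Set ι | i ∈ p.2} =
        π.real ({p : Set ι × Set ι | i ∈ p.2} ∩ {p | i ∈ p.1}) +
          π.real ({p : Set ι × Set ι | i ∈ p.2} \ {p | i ∈ p.1}) :=
      (measureReal_inter_add_sdiff (measurableSet_setOf.2 (hm1 i))).symm
    have h2 : π.real {p : Set ι × Set ι | i ∈ p.1} =
        π.real ({p : Set ι × Set ι | i ∈ p.1} ∩ {p | i ∈ p.2}) +
          π.real ({p : Set ι × Set ι | i ∈ p.1} \ {p | i ∈ p.2}) :=
      (measureReal_inter_add_sdiff (measurableSet_setOf.2 (hm2 i))).symm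
    have h3 : {p : Set ι × Set ι | i ∈ p.1} \ {p | i ∈ p.2} = {p | i ∈ p.1 ∧ i ∉ p.2} := by
      ext p; simp only [Set.mem_sdiff, Set.mem_setOf_eq]
    have h4 : {p : Set ι × Set ι | i ∈ p.2} \ {p | i ∈ p.1} = {p | i ∈ p.2 ∧ i ∉ p.1} := by
      ext p; simp only [Set.mem_sdiff, Set.mem_setOf_eq]
    rw [h3, hN0 i, add_zero, Set.inter_comm] at h2
    rw [h4] at h1
    linarith
  -- both one-sided differences are at most `π(U)`
  have hA : π.real (Prod.snd ⁻¹' E) ≤ π.real (Prod.fst ⁻¹' E) + π.real U := by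
    calc π.real (Prod.snd ⁻¹' E) ≤ π.real (Prod.fst ⁻¹' E ∪ U) :=
          measureReal_mono (fun p hp => by
            by_cases h1 : p.1 ∈ E
            · exact Or.inl h1
            · exact Or.inr (hdis p fun h => h1 (h.2 hp))) (measure_ne_top _ _)
      _ ≤ π.real (Prod.fst ⁻¹' E) + π.real U := measureReal_union_le _ _
  have hB : π.real (Prod.fst ⁻¹' E) ≤ π.real (Prod.snd ⁻¹' E) + π.real U := by
    calc π.real (Prod.fst ⁻¹' E) ≤ π.real (Prod.snd ⁻¹' E ∪ U) :=
          measureReal_mono (fun p hp => by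
            by_cases h2 : p.2 ∈ E
            · exact Or.inl h2
            · exact Or.inr (hdis p fun h => h2 (h.1 hp))) (measure_ne_top _ _)
      _ ≤ π.real (Prod.snd ⁻¹' E) + π.real U := measureReal_union_le _ _
  rw [abs_le]
  constructor <;> linarith

/-- **Total variation on a window under stochastic domination**: if the probability measures `μ, ν` on `Set ι`
(`ι` countable) satisfy `μ(A) ≤ ν(A)` for every increasing LOCAL event `A`, then for every event `E` determined by the
finite set `F` of coordinates, `|ν(E) − μ(E)| ≤ Σ_{i ∈ F} (ν(i ∈ ω) − μ(i ∈ ω))` (Strassen's coupling — the tree's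
`exists_monotoneCoupling_of_isLocalEvent` — and the computation of Liggett's Cor. II.2.8).
[cite: Liggett2005, Thm. II.2.4 and Cor. II.2.8; Grimmett2006, §2.1 (Strassen's theorem)] -/
theorem abs_measureReal_sub_le_sum_of_isLocalEvent_le [Countable ι] (μ ν : Measure (Set ι)) [IsProbabilityMeasure μ]
    [IsProbabilityMeasure ν] (h : ∀ A : Set (Set ι), IsLocalEvent A → IsUpperSet A → μ A ≤ ν A)
    (F : Finset ι) {E : Set (Set ι)} (hE : DeterminedBy E ↑F) :
    |ν.real E - μ.real E| ≤ ∑ i ∈ F, (ν.real {ω | i ∈ ω} - μ.real {ω | i ∈ ω}) := by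
  obtain ⟨π, hπ, h1, h2, hle⟩ := exists_monotoneCoupling_of_isLocalEvent h
  have hEm : MeasurableSet E := hE.measurableSet_of_finset
  have hJm : ∀ i : ι, MeasurableSet {ω : Set ι | i ∈ ω} := fun i => measurableSet_setOf.2 (measurable_set_mem i)
  rw [← h1, ← h2, map_measureReal_apply measurable_snd hEm, map_measureReal_apply measurable_fst hEm]
  refine (abs_measureReal_snd_sub_fst_le_sum π hle F hE).trans (le_of_eq (Finset.sum_congr rfl fun i _ => ?_))
  rw [map_measureReal_apply measurable_snd (hJm i), map_measureReal_apply measurable_fst (hJm i)]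
  rfl

end Strassen

/-! ### The free region law as a measure on `ℤ^d`-configurations, and its domination -/

variable {d : ℕ}

/-- A lifted configuration of the edges of the finite piece `(Λ, E_Λ)` consists of edges of `E_Λ`. [cite: Grimmett2006, §4.2] -/
theorem liftEdges_subset_edgesIn {Λ : Finset (Site d)} {ξ : BondConfig ↥Λ} (hξ : ξ ⊆ (finsetGraph (zdGraph d) Λ).edgeSet) :
    liftEdges Λ ξ ⊆ ↑(edgesIn (zdGraph d) Λ) := by
  rintro _ ⟨e', he', rfl⟩
  have h := hξ he'
  induction e' using Sym2.ind with
  | h a b =>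
    rw [SimpleGraph.mem_edgeSet, finsetGraph_adj_iff] at h
    rw [Sym2.map_mk, Finset.mem_coe, mem_edgesIn_iff, SimpleGraph.mem_edgeSet]
    refine ⟨h, fun x hx => ?_⟩
    rcases Sym2.mem_iff.1 hx with rfl | rfl
    · exact a.2
    · exact b.2

/-- The region laws do not see the difference between events that agree on configurations inside `E_Λ`.
[cite: Grimmett2006, §4.2 (4.11)–(4.12)] -/
theorem rcMeasure_region_real_congr_edgesIn {p q : ℝ} (hp : p ∈ Set.Icc (0 : ℝ) 1) (hq : 0 < q) (Λ : Finset (Site d))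
    (B : Set ↥Λ) {A A' : Set (BondConfig (Site d))}
    (h : ∀ ω : BondConfig (Site d), ω ⊆ ↑(edgesIn (zdGraph d) Λ) → (ω ∈ A ↔ ω ∈ A')) :
    (rcMeasure (finsetGraph (zdGraph d) Λ) p q B).real (liftEdges Λ ⁻¹' A) =
      (rcMeasure (finsetGraph (zdGraph d) Λ) p q B).real (liftEdges Λ ⁻¹' A') :=
  le_antisymm (rcMeasure_real_mono_on_edgeSets _ hp hq B fun _ hξ hA => (h _ (liftEdges_subset_edgesIn hξ)).1 hA)
    (rcMeasure_real_mono_on_edgeSets _ hp hq B fun _ hξ hA => (h _ (liftEdges_subset_edgesIn hξ)).2 hA)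

/-- **Domination of the free region law by a measure lying above `φ⁰_Λ` on increasing `E_Λ`-events**: if
`φ⁰_{Λ,p,q}(A) ≤ ν(A)` for every increasing event `A` determined by `E_Λ`, then `φ⁰_Λ` (read on `ℤ^d` through
`liftEdges Λ`) is below `ν` on every increasing LOCAL event (reduce `A` to its `E_Λ`-part `{ω | ω ∩ E_Λ ∈ A} ⊆ A`).
[cite: Grimmett2006, Lemma (4.14)(b) and §4.3 (4.21)] -/
theorem map_liftEdges_free_le_of_regionFreeReal_le {p q : ℝ} (hp : p ∈ Set.Icc (0 : ℝ) 1) (hq : 0 < q)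
    (Λ : Finset (Site d)) (ν : Measure (BondConfig (Site d))) [IsFiniteMeasure ν]
    (hν : ∀ A : Set (BondConfig (Site d)), IsUpperSet A → DeterminedBy A ↑(edgesIn (zdGraph d) Λ) →
      regionFreeReal d p q Λ A ≤ ν.real A)
    (A : Set (BondConfig (Site d))) (hAl : IsLocalEvent A) (hA : IsUpperSet A) :
    (rcMeasure (finsetGraph (zdGraph d) Λ) p q ∅).map (liftEdges Λ) A ≤ ν A := by
  haveI := isProbabilityMeasure_rcMeasure (finsetGraph (zdGraph d) Λ) hp hq (∅ : Set ↥Λ)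
  have hAm : MeasurableSet A := by obtain ⟨F, hF⟩ := hAl; exact hF.measurableSet_of_finset
  set A' : Set (BondConfig (Site d)) := {ω | ω ∩ ↑(edgesIn (zdGraph d) Λ) ∈ A} with hA'
  have hA'up : IsUpperSet A' := fun ω₁ ω₂ hle h₁ => hA (Set.inter_subset_inter_left _ hle) h₁
  have hA'det : DeterminedBy A' ↑(edgesIn (zdGraph d) Λ) := by
    rw [determinedBy_iff]
    intro ω₁ ω₂ hω
    simp only [hA', Set.mem_setOf_eq, hω]
  have hreal : ((rcMeasure (finsetGraph (zdGraph d) Λ) p q ∅).map (liftEdges Λ)).real A ≤ ν.real A := by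
    rw [map_measureReal_apply (measurable_of_finite _) hAm,
      rcMeasure_region_real_congr_edgesIn hp hq Λ ∅ (A' := A') fun ω hω => by
        simp only [hA', Set.mem_setOf_eq, Set.inter_eq_self_of_subset_left hω]]
    exact (hν A' hA'up hA'det).trans (measureReal_mono (fun ω hω => hA Set.inter_subset_left hω) (measure_ne_top _ _))
  rw [← ofReal_measureReal (measure_ne_top _ _), ← ofReal_measureReal (measure_ne_top _ _)]
  exact ENNReal.ofReal_le_ofReal hreal

/-! ### The core: `|ν(E) − φ⁰_Λ(E)| ≤ Σ_{e ∈ F} φ¹_Λ(J(e, Λ))` for `ν` between `φ⁰_Λ` and `φ¹_Λ` -/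

/-- **Core total-variation bound.** Let `ν` be a probability measure on configurations of `ℤ^d` lying between the
free and the wired law of the finite region `Λ` on increasing `E_Λ`-events (`φ⁰_Λ(A) ≤ ν(A) ≤ φ¹_Λ(A)`). Then for
every event `E` determined by a set `F ⊆ E_Λ` of edges,
`|ν(E) − φ⁰_{Λ,p,q}(E)| ≤ Σ_{e ∈ F} φ¹_{Λ,p,q}(J(e, Λ))`, `J(e, Λ) = {∃ x ∈ e, ∃ y ∈ ∂Λ, x ↔ y in Λ}`
(`0 ≤ p ≤ 1`, `q ≥ 1`): Strassen's coupling of `φ⁰_Λ ≤_st ν` plus the one-edge influence bound.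
[cite: Liggett2005, Thm. II.2.4 and Cor. II.2.8; DuminilCopin2019, §1.2 Exercise 10 (3); Alexander1998, §2 (2.7)] -/
theorem abs_real_sub_regionFreeReal_le_sum_of_sandwich {p q : ℝ} (hp : p ∈ Set.Icc (0 : ℝ) 1) (hq : 1 ≤ q) (Λ : Finset (Site d))
    (ν : Measure (BondConfig (Site d))) [IsProbabilityMeasure ν]
    (hν : ∀ A : Set (BondConfig (Site d)), IsUpperSet A → DeterminedBy A ↑(edgesIn (zdGraph d) Λ) →
      regionFreeReal d p q Λ A ≤ ν.real A)
    (hν' : ∀ A : Set (BondConfig (Site d)), IsUpperSet A → DeterminedBy A ↑(edgesIn (zdGraph d) Λ) →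
      ν.real A ≤ regionWiredReal d p q Λ A)
    {F : Finset (Sym2 (Site d))} (hF : F ⊆ edgesIn (zdGraph d) Λ) {E : Set (BondConfig (Site d))}
    (hE : DeterminedBy E ↑F) :
    |ν.real E - regionFreeReal d p q Λ E| ≤
      ∑ e ∈ F, regionWiredReal d p q Λ
        {ω | ∃ x ∈ e, ∃ y ∈ innerBoundary (zdGraph d) Λ, ω ∈ openConnIn (↑Λ : Set (Site d)) x y} := by
  have hq0 : 0 < q := one_pos.trans_le hq
  haveI := isProbabilityMeasure_rcMeasure (finsetGraph (zdGraph d) Λ) hp hq0 (∅ : Set ↥Λ)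
  set μ : Measure (BondConfig (Site d)) := (rcMeasure (finsetGraph (zdGraph d) Λ) p q ∅).map (liftEdges Λ) with hμ
  haveI : IsProbabilityMeasure μ := Measure.isProbabilityMeasure_map (measurable_of_finite _).aemeasurable
  have hEm : MeasurableSet E := hE.measurableSet_of_finset
  have hμE : μ.real E = regionFreeReal d p q Λ E := by
    rw [hμ, map_measureReal_apply (measurable_of_finite _) hEm, regionFreeReal]
  have key := abs_measureReal_sub_le_sum_of_isLocalEvent_le μ ν
    (map_liftEdges_free_le_of_regionFreeReal_le hp hq0 Λ ν hν) F hE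
  rw [hμE] at key
  refine key.trans (Finset.sum_le_sum fun e he => ?_)
  -- the one-edge marginal: `ν(e open) − φ⁰_Λ(e open) ≤ φ¹_Λ(e open) − φ⁰_Λ(e open) ≤ φ¹_Λ(J(e, Λ))`
  have heΛ : e ∈ edgesIn (zdGraph d) Λ := hF he
  have hJup : IsUpperSet {ω : BondConfig (Site d) | e ∈ ω} := fun ω₁ ω₂ hle h₁ => hle h₁
  have hJm : MeasurableSet {ω : BondConfig (Site d) | e ∈ ω} := measurableSet_setOf.2 (measurable_set_mem e)
  set W : Finset (Site d) := Λ.filter fun x => x ∈ e with hW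
  have hWΛ : W ⊆ Λ := Finset.filter_subset _ _
  have heW : e ∈ edgesIn (zdGraph d) W := by
    rw [mem_edgesIn_iff] at heΛ ⊢
    exact ⟨heΛ.1, fun x hx => Finset.mem_filter.2 ⟨heΛ.2 x hx, hx⟩⟩
  have hJdet : DeterminedBy {ω : BondConfig (Site d) | e ∈ ω} ↑(edgesIn (zdGraph d) W) := by
    rw [determinedBy_iff]
    intro ω₁ ω₂ hω
    have := Set.ext_iff.1 hω e
    simp only [Set.mem_inter_iff, Finset.mem_coe, heW, and_true] at this
    exact this
  have hJdetΛ : DeterminedBy {ω : BondConfig (Site d) | e ∈ ω} ↑(edgesIn (zdGraph d) Λ) :=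
    hJdet.mono (Finset.coe_subset.2 (edgesIn_zdGraph_mono hWΛ))
  have hμJ : μ.real {ω | e ∈ ω} = regionFreeReal d p q Λ {ω | e ∈ ω} := by
    rw [hμ, map_measureReal_apply (measurable_of_finite _) hJm, regionFreeReal]
  rw [hμJ]
  calc ν.real {ω | e ∈ ω} - regionFreeReal d p q Λ {ω | e ∈ ω}
      ≤ regionWiredReal d p q Λ {ω | e ∈ ω} - regionFreeReal d p q Λ {ω | e ∈ ω} :=
        sub_le_sub_right (hν' _ hJup hJdetΛ) _
    _ ≤ regionWiredReal d p q Λ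
          {ω | ∃ x ∈ W, ∃ y ∈ innerBoundary (zdGraph d) Λ, ω ∈ openConnIn (↑Λ : Set (Site d)) x y} :=
        regionWiredReal_sub_regionFreeReal_le hp hq hWΛ hJup hJdet
    _ ≤ regionWiredReal d p q Λ
          {ω | ∃ x ∈ e, ∃ y ∈ innerBoundary (zdGraph d) Λ, ω ∈ openConnIn (↑Λ : Set (Site d)) x y} :=
        regionWiredReal_mono_set d hp hq0 Λ fun ω ⟨x, hx, hrest⟩ => ⟨x, (Finset.mem_filter.1 hx).2, hrest⟩

/-! ### Instances: FK-Gibbs measures, the wired law, conditional laws -/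

section Instances

variable {p q : ℝ} {P P' : Measure (BondConfig (Site d))}

/-- **`|P(E) − φ⁰_{Λ,p,q}(E)| ≤ Σ_{e ∈ F} φ¹_{Λ,p,q}(J(e, Λ))`** for every `P` with `FKGibbs d p q P` and every event `E`
determined by `F ⊆ E_Λ`. [cite: Grimmett2006, Thm. (4.19)(c) (4.21); Liggett2005, Cor. II.2.8; DuminilCopin2019, §1.2 Exercise 10 (3)] -/
theorem FKGibbs.abs_real_sub_regionFreeReal_le_sum (hP : FKGibbs d p q P) (hp : p ∈ Set.Icc (0 : ℝ) 1) (hq : 1 ≤ q)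
    (Λ : Finset (Site d)) {F : Finset (Sym2 (Site d))} (hF : F ⊆ edgesIn (zdGraph d) Λ)
    {E : Set (BondConfig (Site d))} (hE : DeterminedBy E ↑F) :
    |P.real E - regionFreeReal d p q Λ E| ≤
      ∑ e ∈ F, regionWiredReal d p q Λ
        {ω | ∃ x ∈ e, ∃ y ∈ innerBoundary (zdGraph d) Λ, ω ∈ openConnIn (↑Λ : Set (Site d)) x y} := by
  haveI := hP.isProbabilityMeasure
  exact abs_real_sub_regionFreeReal_le_sum_of_sandwich hp hq Λ P (fun A hA hAΛ => hP.regionFreeReal_le Λ hA hAΛ)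
    (fun A hA hAΛ => hP.le_regionWiredReal Λ hA hAΛ) hF hE

/-- **`|φ¹_{Λ,p,q}(E) − φ⁰_{Λ,p,q}(E)| ≤ Σ_{e ∈ F} φ¹_{Λ,p,q}(J(e, Λ))`**: the influence of the boundary condition on an
ARBITRARY event determined by `F ⊆ E_Λ`. [cite: Alexander1998, §2 (2.7) and Thm. 3.4 (proof); Liggett2005, Cor. II.2.8; DuminilCopin2019, §1.2 Exercise 10 (3)] -/
theorem abs_regionWiredReal_sub_regionFreeReal_le_sum (hp : p ∈ Set.Icc (0 : ℝ) 1) (hq : 1 ≤ q) (Λ : Finset (Site d))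
    {F : Finset (Sym2 (Site d))} (hF : F ⊆ edgesIn (zdGraph d) Λ) {E : Set (BondConfig (Site d))}
    (hE : DeterminedBy E ↑F) :
    |regionWiredReal d p q Λ E - regionFreeReal d p q Λ E| ≤
      ∑ e ∈ F, regionWiredReal d p q Λ
        {ω | ∃ x ∈ e, ∃ y ∈ innerBoundary (zdGraph d) Λ, ω ∈ openConnIn (↑Λ : Set (Site d)) x y} := by
  have hq0 : 0 < q := one_pos.trans_le hq
  haveI := isProbabilityMeasure_rcMeasure (finsetGraph (zdGraph d) Λ) hp hq0 (wiredBoundary (zdGraph d) Λ)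
  set M : Measure (BondConfig (Site d)) :=
    (rcMeasure (finsetGraph (zdGraph d) Λ) p q (wiredBoundary (zdGraph d) Λ)).map (liftEdges Λ) with hM
  haveI : IsProbabilityMeasure M := Measure.isProbabilityMeasure_map (measurable_of_finite _).aemeasurable
  have hreal : ∀ A : Set (BondConfig (Site d)), MeasurableSet A → M.real A = regionWiredReal d p q Λ A := fun A hA => by
    rw [hM, map_measureReal_apply (measurable_of_finite _) hA, regionWiredReal]
  have h := abs_real_sub_regionFreeReal_le_sum_of_sandwich hp hq Λ M
    (fun A hA hAΛ => by
      rw [hreal A hAΛ.measurableSet_of_finset]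
      exact regionFreeReal_le_regionWiredReal_of_subset hp hq (subset_refl Λ) hA hAΛ)
    (fun A _ hAΛ => by rw [hreal A hAΛ.measurableSet_of_finset]) hF hE
  rwa [hreal E hE.measurableSet_of_finset] at h

/-- **`|P(E) − φ¹_{Λ,p,q}(E)| ≤ 2 · Σ_{e ∈ F} φ¹_{Λ,p,q}(J(e, Λ))`**: every FK-Gibbs measure is within twice the one-arm
sum of the WIRED region law, on every event determined by `F ⊆ E_Λ`. [cite: Grimmett2006, Thm. (4.19)(c) (4.21); Liggett2005, Cor. II.2.8] -/
theorem FKGibbs.abs_real_sub_regionWiredReal_le_two_mul_sum (hP : FKGibbs d p q P) (hp : p ∈ Set.Icc (0 : ℝ) 1)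
    (hq : 1 ≤ q) (Λ : Finset (Site d)) {F : Finset (Sym2 (Site d))} (hF : F ⊆ edgesIn (zdGraph d) Λ)
    {E : Set (BondConfig (Site d))} (hE : DeterminedBy E ↑F) :
    |P.real E - regionWiredReal d p q Λ E| ≤
      2 * ∑ e ∈ F, regionWiredReal d p q Λ
        {ω | ∃ x ∈ e, ∃ y ∈ innerBoundary (zdGraph d) Λ, ω ∈ openConnIn (↑Λ : Set (Site d)) x y} := by
  have h1 := FKGibbs.abs_real_sub_regionFreeReal_le_sum hP hp hq Λ hF hE
  have h2 := abs_regionWiredReal_sub_regionFreeReal_le_sum hp hq Λ hF hE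
  rw [abs_le] at h1 h2 ⊢
  constructor <;> linarith [h1.1, h1.2, h2.1, h2.2]

/-- **Two FK-Gibbs measures at `(p, q)` differ by at most `2 · Σ_{e ∈ F} φ¹_{Λ,p,q}(J(e, Λ))`** on every event
determined by `F ⊆ E_Λ`. [cite: Grimmett2006, Thm. (4.19)(c) (4.21) and (4.36); Liggett2005, Cor. II.2.8] -/
theorem FKGibbs.abs_real_sub_real_le_two_mul_sum (hP : FKGibbs d p q P) (hP' : FKGibbs d p q P')
    (hp : p ∈ Set.Icc (0 : ℝ) 1) (hq : 1 ≤ q) (Λ : Finset (Site d)) {F : Finset (Sym2 (Site d))}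
    (hF : F ⊆ edgesIn (zdGraph d) Λ) {E : Set (BondConfig (Site d))} (hE : DeterminedBy E ↑F) :
    |P.real E - P'.real E| ≤
      2 * ∑ e ∈ F, regionWiredReal d p q Λ
        {ω | ∃ x ∈ e, ∃ y ∈ innerBoundary (zdGraph d) Λ, ω ∈ openConnIn (↑Λ : Set (Site d)) x y} := by
  have h1 := FKGibbs.abs_real_sub_regionFreeReal_le_sum hP hp hq Λ hF hE
  have h2 := FKGibbs.abs_real_sub_regionFreeReal_le_sum hP' hp hq Λ hF hE
  rw [abs_le] at h1 h2 ⊢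
  constructor <;> linarith [h1.1, h1.2, h2.1, h2.2]

/-- The conditional law `P(· | H)` (Mathlib's `ProbabilityTheory.cond`) evaluated in `ℝ`. [folklore] -/
theorem condReal_eq (P : Measure (BondConfig (Site d))) [IsFiniteMeasure P] {H : Set (BondConfig (Site d))}
    (hHm : MeasurableSet H) {A : Set (BondConfig (Site d))} :
    (ProbabilityTheory.cond P H).real A = P.real (A ∩ H) / P.real H := by
  rw [measureReal_def, ProbabilityTheory.cond_apply hHm P A, ENNReal.toReal_mul, ENNReal.toReal_inv, Set.inter_comm,
    ← measureReal_def, ← measureReal_def, div_eq_inv_mul]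

/-- **Conditional laws: `|P(E | H) − φ⁰_{Λ,p,q}(E)| ≤ Σ_{e ∈ F} φ¹_{Λ,p,q}(J(e, Λ))`** for `P` with `FKGibbs d p q P`,
`H` determined by finitely many pairs off `E_Λ` with `P(H) > 0`, and `E` determined by `F ⊆ E_Λ` (the sandwich
puts `P(· | H)` between `φ⁰_Λ` and `φ¹_Λ` on increasing `E_Λ`-events). [cite: Grimmett2006, Lemma (4.13) and Lemma (4.14)(b); Liggett2005, Cor. II.2.8; Alexander1998, (1.1)] -/
theorem FKGibbs.abs_condReal_sub_regionFreeReal_le_sum (hP : FKGibbs d p q P) (hp : p ∈ Set.Icc (0 : ℝ) 1) (hq : 1 ≤ q)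
    (Λ : Finset (Site d)) {H : Set (BondConfig (Site d))} (T : Finset (Sym2 (Site d)))
    (hT : Disjoint (↑T : Set (Sym2 (Site d))) ↑(edgesIn (zdGraph d) Λ)) (hH : DeterminedBy H ↑T) (hH0 : 0 < P.real H)
    {F : Finset (Sym2 (Site d))} (hF : F ⊆ edgesIn (zdGraph d) Λ) {E : Set (BondConfig (Site d))}
    (hE : DeterminedBy E ↑F) :
    |P.real (E ∩ H) / P.real H - regionFreeReal d p q Λ E| ≤
      ∑ e ∈ F, regionWiredReal d p q Λ
        {ω | ∃ x ∈ e, ∃ y ∈ innerBoundary (zdGraph d) Λ, ω ∈ openConnIn (↑Λ : Set (Site d)) x y} := by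
  haveI := hP.isProbabilityMeasure
  have hHm : MeasurableSet H := hH.measurableSet_of_finset
  have hPH : P H ≠ 0 := fun h0 => hH0.ne' (by rw [measureReal_def, h0, ENNReal.toReal_zero])
  haveI := ProbabilityTheory.cond_isProbabilityMeasure (μ := P) hPH
  have h := abs_real_sub_regionFreeReal_le_sum_of_sandwich hp hq Λ (ProbabilityTheory.cond P H)
    (fun A hA hAΛ => by
      rw [condReal_eq P hHm, le_div_iff₀ hH0]
      exact hP.free_mul_le Λ T hA hAΛ hT hH)
    (fun A hA hAΛ => by
      rw [condReal_eq P hHm, div_le_iff₀ hH0]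
      exact hP.le_wired_mul Λ T hA hAΛ hT hH) hF hE
  rwa [condReal_eq P hHm] at h

/-- **WEAK MIXING FOR ARBITRARY LOCAL EVENTS, in terms of the one-arm sum:
`|P(E ∩ H) − P(E)·P(H)| ≤ 2 · P(H) · Σ_{e ∈ F} φ¹_{Λ,p,q}(J(e, Λ))`** for every FK-Gibbs measure `P` at `(p, q)`,
`E` determined by `F ⊆ E_Λ`, `H` determined by finitely many pairs off `E_Λ` (`0 ≤ p ≤ 1`, `q ≥ 1`).
[cite: Alexander1998, (1.1) and p. 444 (sup |P(A | B) − P(A)|); Liggett2005, Cor. II.2.8; Grimmett2006, Lemma (4.13), Lemma (4.14)(b)] -/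
theorem FKGibbs.abs_real_inter_sub_mul_le_two_mul_sum (hP : FKGibbs d p q P) (hp : p ∈ Set.Icc (0 : ℝ) 1) (hq : 1 ≤ q)
    (Λ : Finset (Site d)) {H : Set (BondConfig (Site d))} (T : Finset (Sym2 (Site d)))
    (hT : Disjoint (↑T : Set (Sym2 (Site d))) ↑(edgesIn (zdGraph d) Λ)) (hH : DeterminedBy H ↑T)
    {F : Finset (Sym2 (Site d))} (hF : F ⊆ edgesIn (zdGraph d) Λ) {E : Set (BondConfig (Site d))}
    (hE : DeterminedBy E ↑F) :
    |P.real (E ∩ H) - P.real E * P.real H| ≤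
      2 * P.real H * ∑ e ∈ F, regionWiredReal d p q Λ
        {ω | ∃ x ∈ e, ∃ y ∈ innerBoundary (zdGraph d) Λ, ω ∈ openConnIn (↑Λ : Set (Site d)) x y} := by
  haveI := hP.isProbabilityMeasure
  have hS : 0 ≤ ∑ e ∈ F, regionWiredReal d p q Λ
      {ω | ∃ x ∈ e, ∃ y ∈ innerBoundary (zdGraph d) Λ, ω ∈ openConnIn (↑Λ : Set (Site d)) x y} :=
    Finset.sum_nonneg fun e _ => measureReal_nonneg
  rcases (measureReal_nonneg (μ := P) (s := H)).eq_or_lt with hH0 | hH0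
  · -- `P(H) = 0`
    have h1 : P.real (E ∩ H) = 0 :=
      le_antisymm ((measureReal_mono Set.inter_subset_right (measure_ne_top _ _)).trans hH0.symm.le) measureReal_nonneg
    rw [h1, ← hH0, mul_zero, sub_zero, abs_zero, mul_zero, zero_mul]
  · have h1 := FKGibbs.abs_condReal_sub_regionFreeReal_le_sum hP hp hq Λ T hT hH hH0 hF hE
    have h2 := FKGibbs.abs_real_sub_regionFreeReal_le_sum hP hp hq Λ hF hE
    have h3 : |P.real (E ∩ H) / P.real H - P.real E| ≤
        2 * ∑ e ∈ F, regionWiredReal d p q Λ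
          {ω | ∃ x ∈ e, ∃ y ∈ innerBoundary (zdGraph d) Λ, ω ∈ openConnIn (↑Λ : Set (Site d)) x y} := by
      rw [abs_le] at h1 h2 ⊢
      constructor <;> linarith [h1.1, h1.2, h2.1, h2.2]
    have heq : P.real (E ∩ H) - P.real E * P.real H = P.real H * (P.real (E ∩ H) / P.real H - P.real E) := by
      field_simp
    rw [heq, abs_mul, abs_of_pos hH0]
    calc P.real H * |P.real (E ∩ H) / P.real H - P.real E|
        ≤ P.real H * (2 * ∑ e ∈ F, regionWiredReal d p q Λ
          {ω | ∃ x ∈ e, ∃ y ∈ innerBoundary (zdGraph d) Λ, ω ∈ openConnIn (↑Λ : Set (Site d)) x y}) :=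
          mul_le_mul_of_nonneg_left h3 hH0.le
      _ = _ := by ring

end Instances


end BoundaryInfluence

end Summit.CriticalPhenomena.PercolationContinuityZ3.Theorems.FK

end
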